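import Mathlib.Analysis.Normed.Lp.PiLp
import Literature.Computability.Cryptography.PQCRingLWE
import HarnessLib

/-!
# Module lattices and the Langlois–Stehlé worst-case hardness of Module-LWE (shape)

Topic `Computability/Cryptography`. Companion of `PQCRingLWE.lean` (which records the decision
Ring- and Module-LWE assumptions `RingLWEDecisionAssumption`, `ModuleLWEDecisionAssumption`, the
bare-instance Ideal-SVP hardness `IdealSVPQuantumHardness` and the SHAPE of the
Lyubashevsky–Peikert–Regev main theorem `LPRMainTheoremStatement`) for MODULE lattices of rank `d`:

* `RingLWE.moduleEmbedding K d` — the coordinatewise canonical embedding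
  `σ_H = (σ, …, σ) : K^d → (K_ℝ)^d` (Langlois–Stehlé 2015, §2.2 "Ideal and module lattices": "The map
  `(σ_H, …, σ_H)` is an embedding from `K^d` to `ℝ^N`, with `N = nd`"), into the `ℓ²`-product of `d`
  copies of Mathlib's Euclidean mixed space;
* `RingLWE.IsModuleLatticeInstance K d I` — the integer lattice instance `I` is, up to a linear
  isometry, the module lattice `σ_H(M)` of a finitely generated `𝓞 K`-module `M ⊆ K^d` of full rank
  (ibid.: "`M ⊆ K^d` a module of `R` … The set `σ_H(M)` is a module lattice … if `M` is a rank `d`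
  module and if `K` has degree `n`, then the corresponding module lattice has dimension `N = nd`"),
  exactly parallel to `RingLWE.IsIdealLatticeInstance` (the case `d = 1`);
* `UniformQCircuitFamily.sivpSuccessProb` and `ModuleSIVPQuantumHardness` — quantum worst-case
  hardness of `SIVP_γ` restricted to module lattices ("Mod-SIVP", ibid.), in the same
  eventually/for-every-family form as `IdealSVPQuantumHardness`;
* `LangloisStehle2015MainTheoremShape d` — the SHAPE of Langlois–Stehlé 2015, Thms 4.7–4.8
  ("a (quantum) reduction from Mod-SIVP to M-LWE in both its search and decision versions", §1
  p. 2) for the power-of-two cyclotomic family and a FIXED module rank `d` (the ML-KEM / ML-DSA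
  regime: `d ∈ {2, …, 8}`, `n = 256`), recorded as a `def … : Prop` with the audit caveats below —
  deliberately NOT asserted as a theorem.

## Audit against the source (read with the audit of `LPRMainTheoremStatement`)

PRINTED (Thm 4.7, p. 16): "Let `ε(N) = N^{−ω(1)}`, `α ∈ (0,1)` and `q ≥ 2` of known factorization
such that `αq > 2√d·ω(√log n)`. There is a quantum reduction from solving `Mod-GIVP^{η_ε}_γ` in
polynomial time (in the worst case, with high probability) to solving `M-SLWE_{q,Ψ≤α}` in polynomial
time with non-negligible advantage with `γ = √(8Nd)·ω(√log n)/α`. Assume that `q` is prime,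
`q ≤ poly(N)` and that `q = 1 mod ν`. Then there exists a polynomial time reduction from
`M-SLWE_{q,Ψ≤α}` to `M-LWE_{q,Υ_α}`." (Thm 4.8, p. 17, then moves to a modulus `p` of arbitrary
arithmetic shape at the price `β ≥ α·max(1,q/p)·n^{1/4}N^{1/2}·ω(log² N)`.)
(S1) Worst-case side: printed `Mod-GIVP^{η_ε}_γ`; recorded as Mod-`SIVP` with
`γ = Õ(√(Nd)/α)` — `GIVP^{η_ε}` is implied by `SIVP` up to the factor `η_ε/λ_N ≤ √(ln(2N(1+1/ε))/π)`
(ibid. Lemma 2.6 area), absorbed with the `ω(√log n)` into `Õ`; the intro (p. 2) itself says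
"reduction from Mod-SIVP to M-LWE".
(S2) = (M1) of the LPR audit, module version: LS15 p. 8 "When a module is given as input of a
problem, we consider that we give a lattice basis of the corresponding module lattice … it is
equivalent to give a basis of the module lattice and a pseudo-basis of the module", where the basis
lives in the canonical coordinates `ℝ^N`; here instances are INTEGER bases isometric to `σ_H(M)` by an
unspecified isometry, which hides the coordinates the reduction uses — a WEAKER hardness hypothesis,
hence a STRONGER recorded implication than printed (unsafe direction for consumers; same status as
`IdealSVPQuantumHardness`).
(S3) = (M2)/(M3) of the LPR audit verbatim: the tree's `ModuleLWEDecisionAssumption` uses the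
discretised, non-dual SPHERICAL Gaussian `RingLWE.gaussianError` of parameter `s = n·α·q/√2` with
`poly(n)` samples and secrets uniform in `R_q^d`; LS15 prints `Υ_α` (a distribution over elliptical
Gaussians on `K_ℝ`), secrets in `(R^∨_q)^d` and arbitrarily many samples; for `2^k`-th cyclotomics
`R^∨ = n^{-1}R` and the normal form / discretisation are standard, but the rate-`α` spherical
bounded-sample statement is not literally the printed one.
(S4) Security parameter = degree `n = 2^{k−1}` with `d` FIXED (`N = nd → ∞` as LS15 require, p. 8
"All asymptotic statements involving modules … will be given for N growing to infinity"); thresholds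
`1/n^c` under `∀ᶠ k`; `n = 2^{k-1}` by `ℕ`-subtraction (junk `n = 1` at `k = 0`, harmless under `∀ᶠ`).
(S5) ML-KEM/ML-DSA themselves lie OUTSIDE the printed hypotheses (centred-binomial / uniform-η
secrets and errors of width ≈ 1–3 instead of `αq > 2√d·ω(√log n)`, `m = (k+1)n` samples, and for
ML-KEM `q = 3329 ≢ 1 mod ν = 512`) — cell file REDUCTIONS.md §R2; this file records the theorem's
shape, not a claim about the standards.

## References

* A. Langlois, D. Stehlé, *Worst-case to average-case reductions for module lattices*, Des. Codes
  Cryptogr. 75 (2015) 565–599: §1 (p. 2), §2.2 (pp. 7–8), Def. 4.6, Thm 4.7 (p. 16), Thm 4.8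
  (p. 17). [LangloisStehle2014]
* V. Lyubashevsky, C. Peikert, O. Regev, *On ideal lattices and learning with errors over rings*,
  J. ACM 60 (2013), Thm 3.6 (the `d = 1` case; `PQCRingLWE.lean`). [LyubashevskyPeikertRegev2013]
* D. Micciancio, S. Goldwasser, *Complexity of lattice problems* (2002), Ch. 7 Def. 7.1 (`SIVP`;
  `Literature.Algebra.EuclideanLattices.SIVP.IsSolution`). [MicciancioGoldwasser2002]
-/

noncomputable section

open scoped ENNReal nonZeroDivisors NumberField
open Filter NumberField NumberField.mixedEmbedding

namespace Literature.Computability.Cryptography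

/-! ### Module lattices -/

namespace RingLWE

variable (K : Type) [Field K] [NumberField K]

open scoped Classical in
/-- The coordinatewise canonical embedding `σ_H = (σ, …, σ) : K^d → (K_ℝ)^d` as a `ℤ`-linear map
into the `ℓ²`-product of `d` copies of Mathlib's Euclidean mixed space (each coordinate: the mixed
embedding `K → K_ℝ` followed by `euclidean.toMixed⁻¹`, as in `ringOfIntegersEquivLattice`).
Langlois–Stehlé 2015, §2.2: "The map `(σ_H, …, σ_H)` is an embedding from `K^d` to `ℝ^N`, with
`N = nd`". Norm caveat of `RingLWE.lean` (`‖·‖_can/√2` on complex places) applies coordinatewise.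
[cite: LangloisStehle2014, §2.2 (Ideal and module lattices)] -/
def moduleEmbedding (d : ℕ) : (Fin d → K) →ₗ[ℤ] PiLp 2 (fun _ : Fin d => euclidean.mixedSpace K) :=
  ((WithLp.linearEquiv 2 ℝ (Fin d → euclidean.mixedSpace K)).symm.toLinearMap.restrictScalars ℤ).comp
    (LinearMap.pi fun i =>
      (((euclidean.toMixed K).symm.toLinearEquiv.toLinearMap.restrictScalars ℤ).comp
        ((mixedEmbedding K).toIntAlgHom.toLinearMap)).comp (LinearMap.proj i))

open scoped Classical in
/-- `I` *is a module lattice of rank `d` over `𝓞 K`*: the integer lattice instance `I` is, up to a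
linear isometry `ℝ^{I.n} ≃ₗᵢ (K_ℝ)^d`, the module lattice `σ_H(M)` of some finitely generated
`𝓞 K`-submodule `M ⊆ K^d` spanning `K^d` over `K` (rank `d`). Langlois–Stehlé 2015, §2.2: "`M ⊆ K^d` a
module of `R` … The set `σ_H(M)` is a module lattice … if `M` is a rank `d` module and if `K` has
degree `n`, then the corresponding module lattice has dimension `N = nd`"; Mod-SIVP/Mod-GIVP are
SIVP/GIVP restricted to these lattices. The case `d = 1` is `IsIdealLatticeInstance` up to the
identification `K^1 = K` (fractional ideals = finitely generated rank-1 submodules). Presentation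
caveat (S2) of the module docstring: the instance is a bare integer basis; the isometry is not part
of the data. [cite: LangloisStehle2014, §2.2 (Ideal and module lattices)] -/
def IsModuleLatticeInstance (d : ℕ) (I : Literature.Algebra.EuclideanLattices.LatticeInstance) : Prop :=
  ∃ (M : Submodule (𝓞 K) (Fin d → K))
    (f : EuclideanSpace ℝ (Fin I.n) ≃ₗᵢ[ℝ] PiLp 2 (fun _ : Fin d => euclidean.mixedSpace K)),
    M.FG ∧ Submodule.span K (M : Set (Fin d → K)) = ⊤ ∧
      I.lattice.map ((f.toLinearEquiv : _ ≃ₗ[ℝ] _).restrictScalars ℤ).toLinearMap =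
        (M.restrictScalars ℤ).map (moduleEmbedding K d)

open scoped Classical in
/-- A module-lattice instance of rank `d` has dimension `N = nd`, `n = [K : ℚ]` (the isometry
preserves `finrank`; `finrank_ℝ K_ℝ = [K : ℚ]`, Mathlib `euclidean.finrank`). Langlois–Stehlé 2015,
§2.2: "the corresponding module lattice has dimension `N = nd`". [cite: LangloisStehle2014, §2.2 (Ideal and module lattices)] -/
theorem IsModuleLatticeInstance.n_eq {d : ℕ} {I : Literature.Algebra.EuclideanLattices.LatticeInstance}
    (h : IsModuleLatticeInstance K d I) : I.n = d * Module.finrank ℚ K := by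
  obtain ⟨-, f, -, -, -⟩ := h
  have h1 := f.toLinearEquiv.finrank_eq
  rw [finrank_euclideanSpace_fin,
    (WithLp.linearEquiv 2 ℝ (Fin d → euclidean.mixedSpace K)).finrank_eq,
    Module.finrank_pi_fintype, Finset.sum_const, Finset.card_univ, Fintype.card_fin, smul_eq_mul,
    euclidean.finrank] at h1
  exact h1

end RingLWE

/-! ### Mod-SIVP: quantum worst-case hardness on module lattices -/

section Statements

open Complexity _root_.Computability

/-- The probability that the uniform quantum circuit family `Q`, given the code of the integer
lattice instance `I`, outputs (the code of) `I.n` vectors solving `SIVP_γ` on `I` (output register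
decoded by `decodeIntMatrix I.n`; deliberate dot-notation extension of `UniformQCircuitFamily`,
parallel to `UniformQCircuitFamily.svpSuccessProb`). (Micciancio–Goldwasser 2002, Ch. 7, Def. 7.1;
Langlois–Stehlé 2015, §2.2 `SIVP_γ`/`GIVP`.) [cite: MicciancioGoldwasser2002, Ch. 7 Def. 7.1] -/
def UniformQCircuitFamily.sivpSuccessProb (Q : UniformQCircuitFamily) (γ : ℕ → ℝ)
    (I : Literature.Algebra.EuclideanLattices.LatticeInstance) : ℝ≥0∞ :=
  ((Q.kernel I.encode).map (decodeIntMatrix I.n)).toOuterMeasure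
    {v | Literature.Algebra.EuclideanLattices.SIVP.IsSolution γ I v}

/-- A success probability is at most `1`. [cite: MicciancioGoldwasser2002, Ch. 7 Def. 7.1] -/
theorem UniformQCircuitFamily.sivpSuccessProb_le_one (Q : UniformQCircuitFamily) (γ : ℕ → ℝ)
    (I : Literature.Algebra.EuclideanLattices.LatticeInstance) : Q.sivpSuccessProb γ I ≤ 1 :=
  (PMF.toOuterMeasure_mono _ (Set.subset_univ _)).trans_eq
    ((PMF.toOuterMeasure_apply_eq_one_iff _ _).2 (Set.subset_univ _))

variable (K : ℕ → Type) [∀ k, Field (K k)] [∀ k, NumberField (K k)]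

/-- **Quantum worst-case hardness of `SIVP_γ` on module lattices of rank `d`** ("Mod-SIVP",
Langlois–Stehlé 2015, §2.2 and the hypothesis of Thms 4.7–4.8), in the eventually/for-every-family
form of `IdealSVPQuantumHardness`: for every polynomial-time uniform quantum circuit family `Q`, for
all sufficiently large `k` there is an integer lattice instance `I` which is (isometric to) a
rank-`d` module lattice over `𝓞 (K k)` (`RingLWE.IsModuleLatticeInstance`) on which `Q` outputs an
`SIVP_γ` solution with probability `< 2/3`. Norms: Mathlib's Euclidean mixed space (`‖·‖_can/√2` on
complex places; an approximation factor is insensitive to the rescaling). Presentation caveat (S2):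
bare integer bases, module structure hidden behind `∃ M ∃ isometry` — WEAKER than the printed Mod-SIVP
hypothesis, so consuming `(h : ModuleSIVPQuantumHardness …)` in place of it is the UNSAFE direction.
[cite: LangloisStehle2014, §2.2 and Thm 4.7 (hypothesis)] -/
def ModuleSIVPQuantumHardness (d : ℕ) (γ : ℕ → ℝ) : Prop :=
  ∀ Q : UniformQCircuitFamily, ∀ᶠ k in atTop,
    ∃ I : Literature.Algebra.EuclideanLattices.LatticeInstance,
      RingLWE.IsModuleLatticeInstance (K k) d I ∧ Q.sivpSuccessProb γ I < 2 / 3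

/-- **Shape of the Langlois–Stehlé main theorem for Module-LWE** (Des. Codes Cryptogr. 75 (2015),
Thms 4.7–4.8; §1 p. 2: "a (quantum) reduction from Mod-SIVP to M-LWE in both its search and decision
versions"), RECORDED AS A STATEMENT — a `def … : Prop`, NOT asserted as a theorem, and (audit
(S1)–(S5) of the module docstring) not a literal transcription either. For the power-of-two cyclotomic
family `K k = ℚ(ζ_{2^k})` of degree `n = 2^{k−1}` and a FIXED module rank `d ≥ 1` (`N = nd`): let
`q k` be primes with `q k ≡ 1 (mod 2^k)` eventually (the conductor `ν = 2^k`; Thm 4.7's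
search-to-decision clause) and `q ≤ poly(n)`, sample counts `m ≤ poly(n)`, rates `0 < α k < 1` with
`α q/√(log n) → ∞` (printed: `αq > 2√d·ω(√log n)`, `d` fixed). Then for some approximation factor
`γ = Õ(√(Nd)/α)` (printed for `Mod-GIVP^{η_ε}`: `γ = √(8Nd)·ω(√log n)/α`; recorded:
`γ(N) ≤ C·(√(nd)·√d/α)·(log(nd))^e` eventually), quantum hardness of `SIVP_γ` on rank-`d` module
lattices of `K k` (bare presentation `ModuleSIVPQuantumHardness`) implies the decision Module-LWE
assumption of rank `d` (`ModuleLWEDecisionAssumption`, power basis encoding, spherical error parameter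
`s k = n·α k·q k/√2` — caveat (S3)). Polynomial bounds are in the DEGREE `n = 2^{k−1}` (not in `k`),
written inline as `∃ P : Polynomial ℕ, ∀ k, q k ≤ P.eval (n k)`. Users take
`(h : LangloisStehle2015MainTheoremShape d)` knowing (S2)–(S3).
[cite: LangloisStehle2014, Thm 4.7 and Thm 4.8] -/
def LangloisStehle2015MainTheoremShape (d : ℕ) : Prop :=
  ∀ (q : ℕ → ℕ) (α : ℕ → ℝ) (m : ℕ → ℕ) (hq : ∀ k, (q k).Prime),
    haveI : ∀ k, NeZero (q k) := fun k => ⟨(hq k).ne_zero⟩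
    let n : ℕ → ℕ := fun k => 2 ^ (k - 1)
    0 < d →
    (∀ᶠ k in atTop, q k ≡ 1 [MOD 2 ^ k]) →
    (∃ P : Polynomial ℕ, ∀ k, q k ≤ P.eval (n k)) →
    (∃ P : Polynomial ℕ, ∀ k, m k ≤ P.eval (n k)) →
    (∀ᶠ k in atTop, 0 < α k ∧ α k < 1) →
    Tendsto (fun k => α k * q k / Real.sqrt (Real.log (n k))) atTop atTop →
    ∃ γ : ℕ → ℝ,
      (∃ C e : ℝ, ∀ᶠ k in atTop,
        γ (n k * d) ≤ C * (Real.sqrt (n k * d) * Real.sqrt d / α k) * Real.log (n k * d) ^ e) ∧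
      (ModuleSIVPQuantumHardness (fun k => CyclotomicField (2 ^ k) ℚ) d γ →
        ModuleLWEDecisionAssumption (fun k => CyclotomicField (2 ^ k) ℚ)
          (fun k => (cyclotomicPowerBasis k).basis) (fun _ => d) q
          (fun k => n k * α k * q k / Real.sqrt 2) m)

variable {K} in
/-- Monotonicity: hardness of Mod-`SIVP_{γ'}` implies hardness of Mod-`SIVP_γ` for `γ ≤ γ'` (a
`γ`-solution is a `γ'`-solution). [cite: LangloisStehle2014, §2.2 (SIVP_γ)] -/
theorem ModuleSIVPQuantumHardness.anti {d : ℕ} {γ γ' : ℕ → ℝ} (hγ : γ ≤ γ')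
    (h : ModuleSIVPQuantumHardness K d γ') : ModuleSIVPQuantumHardness K d γ := by
  intro Q
  filter_upwards [h Q] with k hk
  obtain ⟨I, hI, hlt⟩ := hk
  refine ⟨I, hI, lt_of_le_of_lt ?_ hlt⟩
  refine PMF.toOuterMeasure_mono _ fun v hv => ?_
  obtain ⟨h1, h2, h3⟩ := hv.1
  refine ⟨h1, h2, fun i => (h3 i).trans ?_⟩
  exact mul_le_mul_of_nonneg_right (hγ I.n)
    (Literature.Algebra.EuclideanLattices.successiveMinimum_nonneg _ _)

end Statements

end Literature.Computability.Cryptography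

end
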